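import Mathlib.Analysis.Calculus.MeanValue
import Mathlib.Analysis.SpecialFunctions.ExpDeriv
import HarnessLib

/-!
# Fluid computer blueprint — the damped rotor rung for the drain-conversion stage

HONEST FRAMING: low prior, high value-of-information experiment on Tao's machine paradigm; NOT a
claim that NS blows up. This file is an elementary planar ODE estimate (a Lyapunov function for a
rotation with variable damping); nothing is asserted about any fluid equation or about the threshold
gate itself.

## Why

Along the rotor angle `Θ` (`dΘ = r·c·dt`, `ThresholdTransferAngle.lean`) the transfer subsystem of
the threshold gate (`ThresholdGate.lean`) is, after dividing by `r c`, a ROTATION of the carrier `a`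
into the conduit `d` with a state-dependent LINEAR DAMPING `γ(Θ) = κ·ã/(r·c)` on the conduit
(the overdamped drain) plus small forcing:
`da/dΘ = -d + p`, `dd/dΘ = a - γ(Θ)·d + q`.
The successor's drain-conversion statement (HOME/pub-fluidc-bp3/NEXT-STAGES.md, "DRAIN CONVERSION IN
ANGLE FORM") needs, after the damping has been built up to a floor `γ ≥ γ₀ > 0`, that the unconverted
energy `u = a² + d²` decays exponentially IN ANGLE, uniformly for dampings in a band `[γ₀, γ₁]`, and
robustly under forcing. This is the first rung, with explicit constants:

* `DampedRotor.energy_decay` — if `γ₀ ≤ γ(Θ) ≤ γ₁` (`0 < γ₀`), `|a|, |d| ≤ R` and the forcing is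
  `≤ η` on `[0, T)`, then for all `Θ ∈ [0, T]`
  `a(Θ)² + d(Θ)² ≤ 3·exp(-λΘ)·(a(0)² + d(0)²) + 12·R·η/λ`, `λ = γ₀ / (3·(1 + γ₁²))`.

Proof: the quadratic Lyapunov function `V = a² + d² - β·a·d`, `β = γ₀/(1 + γ₁²) ≤ 1/2`, satisfies
`u/2 ≤ V ≤ 3u/2` and `V' ≤ -(β/3)·V + 6Rη`; then `exp(λΘ)·V` is compared with an explicit barrier
(`image_le_of_deriv_right_le_deriv_boundary`). The rate degrades like `1/γ₁²` in the strongly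
overdamped band and like `γ₀` in the underdamped one — the critical-damping optimum recorded in the
design remark of NEXT-STAGES.md.
[cite: Tao2016AveragedNS, §5.5 (the energy-transfer phase of Thm 5.3)]
-/

noncomputable section

open Set Real

namespace Literature.Analysis.FluidPDE.FluidComputer

namespace DampedRotor

/-- The algebraic heart: for `0 < γ₀ ≤ g ≤ γ₁` and `β = γ₀/(1 + γ₁²)`,
`-2g·d² + β·d² - β·a² + β·g·a·d ≤ -(β/2)·(a² + d²)`. [folklore] -/
theorem lyapunov_alg {γ₀ γ₁ g a d : ℝ} (hγ₀ : 0 < γ₀) (hg : γ₀ ≤ g) (hg₁ : g ≤ γ₁) :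
    -2 * g * d ^ 2 + γ₀ / (1 + γ₁ ^ 2) * d ^ 2 - γ₀ / (1 + γ₁ ^ 2) * a ^ 2 +
        γ₀ / (1 + γ₁ ^ 2) * g * (a * d) ≤
      -(γ₀ / (1 + γ₁ ^ 2) / 2) * (a ^ 2 + d ^ 2) := by
  set β := γ₀ / (1 + γ₁ ^ 2) with hβ_def
  have hγ₁ : 0 < γ₁ := hγ₀.trans_le (hg.trans hg₁)
  have h1 : 0 < 1 + γ₁ ^ 2 := by positivity
  have hβ0 : 0 < β := div_pos hγ₀ h1
  have hβγ : β * (1 + γ₁ ^ 2) = γ₀ := by simp only [hβ_def]; field_simp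
  have hβle : β ≤ γ₀ := by
    have : β * 1 ≤ β * (1 + γ₁ ^ 2) := mul_le_mul_of_nonneg_left (by nlinarith) hβ0.le
    linarith
  -- `g·a·d ≤ γ₁|a||d| ≤ (a² + γ₁² d²)/2`
  have h2 : g * (a * d) ≤ γ₁ * (|a| * |d|) := by
    have hg0 : 0 ≤ g := hγ₀.le.trans hg
    have : a * d ≤ |a| * |d| := by rw [← abs_mul]; exact le_abs_self _
    calc g * (a * d) ≤ g * (|a| * |d|) := mul_le_mul_of_nonneg_left this hg0
      _ ≤ γ₁ * (|a| * |d|) := mul_le_mul_of_nonneg_right hg₁ (by positivity)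
  have h3 : 2 * (γ₁ * (|a| * |d|)) ≤ a ^ 2 + γ₁ ^ 2 * d ^ 2 := by
    nlinarith [sq_nonneg (|a| - γ₁ * |d|), sq_abs a, sq_abs d]
  have h4 : β * g * (a * d) ≤ β / 2 * a ^ 2 + β * γ₁ ^ 2 / 2 * d ^ 2 := by
    have := mul_le_mul_of_nonneg_left (h2.trans (by linarith [h3] : γ₁ * (|a| * |d|) ≤
      (a ^ 2 + γ₁ ^ 2 * d ^ 2) / 2)) hβ0.le
    linarith [this]
  -- coefficient of `d²`
  have h5 : β + β * γ₁ ^ 2 / 2 ≤ γ₀ := by nlinarith [hβγ, hβ0.le, sq_nonneg γ₁]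
  have hd2 : 0 ≤ d ^ 2 := sq_nonneg d
  have ha2 : 0 ≤ a ^ 2 := sq_nonneg a
  nlinarith [h4, h5, hβle, mul_le_mul_of_nonneg_right hg hd2, hd2, ha2, hβ0.le]

variable {a d a' d' γ : ℝ → ℝ} {γ₀ γ₁ R η T : ℝ}

/-- **Energy decay of the damped rotor, in angle, robust under forcing.** Let `a, d` be continuous
on `[0, T]` with right derivatives `a', d'` on `[0, T)` such that `|a' + d| ≤ η` and
`|d' - (a - γ·d)| ≤ η` there (a rotation of `a` into `d` with damping `γ` on `d`, forced by `≤ η`),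
with `0 < γ₀ ≤ γ ≤ γ₁` and `|a|, |d| ≤ R` on `[0, T)`. Then for every `Θ ∈ [0, T]`,
`a(Θ)² + d(Θ)² ≤ 3·exp(-λΘ)·(a(0)² + d(0)²) + 12Rη/λ` with `λ = γ₀/(3(1 + γ₁²))`. [folklore] -/
theorem energy_decay (hac : ContinuousOn a (Icc 0 T)) (hdc : ContinuousOn d (Icc 0 T))
    (ha' : ∀ s ∈ Ico 0 T, HasDerivWithinAt a (a' s) (Ici s) s)
    (hd' : ∀ s ∈ Ico 0 T, HasDerivWithinAt d (d' s) (Ici s) s)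
    (hγ₀ : 0 < γ₀) (hγ : ∀ s ∈ Ico 0 T, γ₀ ≤ γ s ∧ γ s ≤ γ₁) (hR : 0 ≤ R) (hη : 0 ≤ η)
    (hab : ∀ s ∈ Ico 0 T, |a s| ≤ R ∧ |d s| ≤ R)
    (hp : ∀ s ∈ Ico 0 T, |a' s + d s| ≤ η) (hq : ∀ s ∈ Ico 0 T, |d' s - (a s - γ s * d s)| ≤ η) :
    ∀ Θ ∈ Icc 0 T, a Θ ^ 2 + d Θ ^ 2 ≤
      3 * exp (-(γ₀ / (3 * (1 + γ₁ ^ 2))) * Θ) * (a 0 ^ 2 + d 0 ^ 2) +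
        12 * R * η / (γ₀ / (3 * (1 + γ₁ ^ 2))) := by
  intro Θ hΘ
  have h1g : 0 < 1 + γ₁ ^ 2 := by positivity
  rcases eq_or_lt_of_le hΘ.1 with h0 | hΘpos
  · subst h0
    simp only [mul_zero, exp_zero, mul_one]
    have : 0 ≤ 12 * R * η / (γ₀ / (3 * (1 + γ₁ ^ 2))) := by positivity
    linarith [sq_nonneg (a 0), sq_nonneg (d 0), this]
  have hT : 0 < T := hΘpos.trans_le hΘ.2
  obtain ⟨hγ00, hγ01⟩ := hγ 0 ⟨le_rfl, hT⟩
  set β := γ₀ / (1 + γ₁ ^ 2) with hβ_def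
  set lam := γ₀ / (3 * (1 + γ₁ ^ 2)) with hlam_def
  have hβ0 : 0 < β := div_pos hγ₀ h1g
  have hlam0 : 0 < lam := by positivity
  have hlam_ne : lam ≠ 0 := hlam0.ne'
  have hlamβ : lam = β / 3 := by simp only [hlam_def, hβ_def]; field_simp
  have hβhalf : β ≤ 1 / 2 := by
    rw [hβ_def, div_le_iff₀ h1g]
    nlinarith [sq_nonneg (γ₁ - 1), hγ00.trans hγ01]
  have hRη : 0 ≤ R * η := mul_nonneg hR hη
  -- the Lyapunov function and its derivative
  set V : ℝ → ℝ := fun s => a s * a s + d s * d s - β * (a s * d s) with hV_def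
  set V' : ℝ → ℝ := fun s => (a' s * a s + a s * a' s) + (d' s * d s + d s * d' s) -
    β * (a' s * d s + a s * d' s) with hV'_def
  have hVc : ContinuousOn V (Icc 0 T) :=
    ((hac.mul hac).add (hdc.mul hdc)).sub (continuousOn_const.mul (hac.mul hdc))
  have hVd : ∀ s ∈ Ico 0 T, HasDerivWithinAt V (V' s) (Ici s) s := fun s hs =>
    (((ha' s hs).mul (ha' s hs)).add ((hd' s hs).mul (hd' s hs))).sub
      (((ha' s hs).mul (hd' s hs)).const_mul β)
  -- sandwich `u/2 ≤ V ≤ 3u/2`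
  have hsand : ∀ s, (a s ^ 2 + d s ^ 2) / 2 ≤ V s ∧ V s ≤ 3 / 2 * (a s ^ 2 + d s ^ 2) := by
    intro s
    have h1 : a s * d s ≤ (a s ^ 2 + d s ^ 2) / 2 := by nlinarith [sq_nonneg (a s - d s)]
    have h2 : -(a s * d s) ≤ (a s ^ 2 + d s ^ 2) / 2 := by nlinarith [sq_nonneg (a s + d s)]
    have h3 := mul_le_mul_of_nonneg_left h1 hβ0.le
    have h4 := mul_le_mul_of_nonneg_left h2 hβ0.le
    have h5 : β * ((a s ^ 2 + d s ^ 2) / 2) ≤ 1 / 2 * ((a s ^ 2 + d s ^ 2) / 2) :=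
      mul_le_mul_of_nonneg_right hβhalf (by positivity)
    have hV : V s = a s ^ 2 + d s ^ 2 - β * (a s * d s) := by simp only [hV_def]; ring
    constructor <;> linarith [hV, h3, h4, h5, sq_nonneg (a s), sq_nonneg (d s)]
  -- the differential inequality `V' + lam V ≤ 6Rη`
  have hineq : ∀ s ∈ Ico 0 T, V' s + lam * V s ≤ 6 * R * η := by
    intro s hs
    obtain ⟨hgs0, hgs1⟩ := hγ s hs
    obtain ⟨haR, hdR⟩ := hab s hs
    set p := a' s + d s with hp_def
    set q := d' s - (a s - γ s * d s) with hq_def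
    have hpη : |p| ≤ η := hp s hs
    have hqη : |q| ≤ η := hq s hs
    have ea : a' s = -d s + p := by simp only [hp_def]; ring
    have ed : d' s = a s - γ s * d s + q := by simp only [hq_def]; ring
    have halg := lyapunov_alg (a := a s) (d := d s) hγ₀ hgs0 hgs1
    rw [← hβ_def] at halg
    -- forcing terms
    have hf1 : a s * p ≤ R * η := by
      have h := le_abs_self (a s * p); rw [abs_mul] at h
      exact h.trans (mul_le_mul haR hpη (abs_nonneg p) hR)
    have hf2 : d s * q ≤ R * η := by
      have h := le_abs_self (d s * q); rw [abs_mul] at h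
      exact h.trans (mul_le_mul hdR hqη (abs_nonneg q) hR)
    have hf3 : -(p * d s) ≤ R * η := by
      have h := neg_le_abs (p * d s); rw [abs_mul] at h
      have h2 : |p| * |d s| ≤ η * R := mul_le_mul hpη hdR (abs_nonneg _) hη
      linarith [h, h2]
    have hf4 : -(a s * q) ≤ R * η := by
      have h := neg_le_abs (a s * q); rw [abs_mul] at h
      exact h.trans (mul_le_mul haR hqη (abs_nonneg q) hR)
    have hf3' := mul_le_mul_of_nonneg_left hf3 hβ0.le
    have hf4' := mul_le_mul_of_nonneg_left hf4 hβ0.le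
    have hβRη : β * (R * η) ≤ 1 / 2 * (R * η) := mul_le_mul_of_nonneg_right hβhalf hRη
    have hu : 0 ≤ a s ^ 2 + d s ^ 2 := by positivity
    have hV3 : β / 3 * V s ≤ β / 2 * (a s ^ 2 + d s ^ 2) := by
      have := mul_le_mul_of_nonneg_left (hsand s).2 (by positivity : 0 ≤ β / 3)
      linarith [this]
    have hid : V' s + lam * V s =
        (-2 * γ s * d s ^ 2 + β * d s ^ 2 - β * a s ^ 2 + β * γ s * (a s * d s)) +
        (2 * (a s * p) + 2 * (d s * q) + β * (-(p * d s)) + β * (-(a s * q))) +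
        β / 3 * V s := by
      simp only [hV'_def, hV_def, ea, ed, hlamβ]; ring
    rw [hid]
    linarith [halg, hf1, hf2, hf3', hf4', hβRη, hV3, hRη]
  -- comparison for `W = exp(lam s) V` against `B = V 0 + (6Rη/lam)(exp(lam s) - 1)`
  have hE : ∀ s, HasDerivAt (fun x => exp (lam * x)) (exp (lam * s) * lam) s := by
    intro s
    have := ((hasDerivAt_id s).const_mul lam).exp
    simpa using this
  have hWc : ContinuousOn (fun s => exp (lam * s) * V s) (Icc 0 T) :=
    (continuous_exp.comp (continuous_const.mul continuous_id)).continuousOn.mul hVc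
  have hWd : ∀ s ∈ Ico 0 T, HasDerivWithinAt (fun x => exp (lam * x) * V x)
      (exp (lam * s) * lam * V s + exp (lam * s) * V' s) (Ici s) s :=
    fun s hs => (hE s).hasDerivWithinAt.mul (hVd s hs)
  have hB : ∀ s, HasDerivAt (fun x => V 0 + 6 * R * η / lam * (exp (lam * x) - 1))
      (6 * R * η / lam * (exp (lam * s) * lam)) s := by
    intro s
    exact (((hE s).sub_const 1).const_mul _).const_add _
  have hcmp := image_le_of_deriv_right_le_deriv_boundary hWc hWd
    (B := fun x => V 0 + 6 * R * η / lam * (exp (lam * x) - 1))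
    (B' := fun s => 6 * R * η / lam * (exp (lam * s) * lam)) (by simp)
    (fun s _ => (hB s).continuousAt.continuousWithinAt) (fun s _ => (hB s).hasDerivWithinAt)
    (fun s hs => by
      have hes : 0 < exp (lam * s) := exp_pos _
      have e : 6 * R * η / lam * (exp (lam * s) * lam) = exp (lam * s) * (6 * R * η) := by
        field_simp
      rw [e, show exp (lam * s) * lam * V s + exp (lam * s) * V' s =
        exp (lam * s) * (V' s + lam * V s) by ring]
      exact mul_le_mul_of_nonneg_left (hineq s hs) hes.le) hΘ
  -- unwind
  have heΘ : 0 < exp (lam * Θ) := exp_pos _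
  have hexp_neg : exp (-lam * Θ) = (exp (lam * Θ))⁻¹ := by
    rw [← exp_neg]; congr 1; ring
  have hC : 0 ≤ 6 * R * η / lam := by positivity
  have hVΘ : V Θ ≤ exp (-lam * Θ) * V 0 + 6 * R * η / lam := by
    have h1 : exp (lam * Θ) * V Θ ≤ V 0 + 6 * R * η / lam * (exp (lam * Θ) - 1) := hcmp
    have h2 : V Θ ≤ (V 0 + 6 * R * η / lam * (exp (lam * Θ) - 1)) / exp (lam * Θ) :=
      (le_div_iff₀' heΘ).2 h1
    have h3 : (V 0 + 6 * R * η / lam * (exp (lam * Θ) - 1)) / exp (lam * Θ) =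
        (exp (lam * Θ))⁻¹ * V 0 + 6 * R * η / lam - 6 * R * η / lam * (exp (lam * Θ))⁻¹ := by
      field_simp
      ring
    rw [hexp_neg]
    rw [h3] at h2
    linarith [h2, mul_nonneg hC (inv_nonneg.2 heΘ.le)]
  have hV0 := (hsand 0).2
  have hlo := (hsand Θ).1
  have hex0 : 0 ≤ exp (-lam * Θ) := (exp_pos _).le
  have hm := mul_le_mul_of_nonneg_left hV0 hex0
  have h1 : a Θ ^ 2 + d Θ ^ 2 ≤ 2 * V Θ := by linarith [hlo]
  have h2 : 2 * V Θ ≤ 2 * (rexp (-lam * Θ) * V 0) + 2 * (6 * R * η / lam) := by linarith [hVΘ]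
  have h3 : 2 * (rexp (-lam * Θ) * V 0) ≤ 3 * rexp (-lam * Θ) * (a 0 ^ 2 + d 0 ^ 2) := by
    have h := hm
    ring_nf at h ⊢
    linarith [h]
  have h4 : 2 * (6 * R * η / lam) = 12 * R * η / lam := by ring
  linarith [h1, h2, h3, h4]

end DampedRotor

end Literature.Analysis.FluidPDE.FluidComputer

end
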